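import Summits.AtomisticToContinuum.Crystallization.Theorems.FrustratedLawDichotomyStrainedPatchHomExteriorLeaf
import Summits.AtomisticToContinuum.Crystallization.Theorems.FrustratedLawDichotomyStrainedPatchHomCutTreeLeaves

/-!
# Strained patch, `(H)` hcp exterior certificate (architecture R3) — E3: an accepted exterior slab (`exteriorOK`, p-exterior leaf) IS A SEMANTIC FACT AT EVERY LEVEL, and
# the COLUMN MENU with the exterior leaf kind (decomp-a2c hand 2, generation 39; structural #14)

`…HomExteriorLeaf.exteriorOK_sound` (the full `hver` shape, any `μ`) packaged for the manifest fold: `semOKH_of_exteriorOK` (one line over `semOKH_of_sound`), and the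
production menu `colLeafE` = listed landed cell | kernel far-field/force leaf `entryLeafOKHC μ₀` | EXTERIOR SLAB LEAF `exteriorOK …` (the leaf label carries the slab's
certificate data), with its fold `semOKH_of_cutOK_colLeafE` / `semOKH_root_of_colManifestE` (`semOKH_of_cutOK_leaves`).  0 sorry; standard axioms.
`--supports stmt-AtomisticToContinuum-27623`.  [formal bookkeeping]
-/

namespace Summit.AtomisticToContinuum.Crystallization.Theorems.FrustratedLawDichotomyStrainedPatchHomExteriorRay

open Summit.AtomisticToContinuum.Crystallization.Theorems.FrustratedLawDichotomyStrainedPatchHomEntryGramHcp (rootCH rootWH)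
open Summit.AtomisticToContinuum.Crystallization.Theorems.FrustratedLawDichotomyStrainedPatchHomEntryLeafHT (semOKH semOKH_of_sound semOKH_anti_box)
open Summit.AtomisticToContinuum.Crystallization.Theorems.FrustratedLawDichotomyStrainedPatchHomForceCentredHcp (entryLeafOKHC)
open Summit.AtomisticToContinuum.Crystallization.Theorems.FrustratedLawDichotomyStrainedPatchHomCutTree (CutTree cutOK coveredAt coveredAt_sound
  semOKH_of_cutOK_leaves semOKH_of_entryLeafOKHC_level)

/-- ★★★ **AN ACCEPTED EXTERIOR SLAB IS A SEMANTIC FACT AT EVERY LEVEL `μ`.** [formal bookkeeping: `semOKH_of_sound` ∘ `exteriorOK_sound`] -/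
theorem semOKH_of_exteriorOK {J : Fin 3 → Fin 3 × Fin 3 → ℤ} {cC wC cH wH : Bx} {ch : List (Bx × Bx × (Fin 3 → Fin 3 → ℤ) × ℤ)} {lmin g : ℤ} {i : Fin 3}
    {c w : Bx} (h : exteriorOK J cC wC cH wH ch lmin g i c w = true) (μ : ℤ) : semOKH μ c w = true :=
  semOKH_of_sound (μ := μ) (fun c w => exteriorOK J cC wC cH wH ch lmin g i c w)
    (fun _ _ hv U ξ hsa hU hbox hξ h0 h2 => exteriorOK_sound hv U ξ hsa hU hbox hξ h0 h2) h

/-- The certificate data of one exterior slab leaf (everything `exteriorOK` takes before the leaf box). -/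
structure ExtLeafData where
  /-- the cell's affine tilt -/
  J : Fin 3 → Fin 3 × Fin 3 → ℤ
  /-- the cell box -/
  cC : Bx
  /-- the cell box half-widths -/
  wC : Bx
  /-- the hull box -/
  cH : Bx
  /-- the hull box half-widths -/
  wH : Bx
  /-- the nested box chain -/
  ch : List (Bx × Bx × (Fin 3 → Fin 3 → ℤ) × ℤ)
  /-- the common curvature floor -/
  lmin : ℤ
  /-- the cell/slab gap -/
  g : ℤ
  /-- the gap coordinate -/
  i : Fin 3

/-- **THE COLUMN LEAF MENU WITH EXTERIOR SLABS**: `inl i` — listed landed cell `L[i]`; `inr (inl ())` — kernel far-field/force leaf `entryLeafOKHC μ₀`; `inr (inr e)` — exterior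
slab with certificate data `e`.  Computable. -/
def colLeafE (L : List (Bx × Bx)) (μ₀ : ℤ) : ℕ ⊕ (Unit ⊕ ExtLeafData) → Bx → Bx → Bool
  | .inl i, c, w => coveredAt L i c w
  | .inr (.inl _), c, w => entryLeafOKHC μ₀ c w
  | .inr (.inr e), c, w => exteriorOK e.J e.cC e.wC e.cH e.wH e.ch e.lmin e.g e.i c w

/-- ★★ **THE MENU FOLD WITH EXTERIOR SLABS**: listed cells certified at `μ`, kernel leaves at `μ₀ ≥ μ`, exterior slabs (every level) + ONE `decide` ⟹ `semOKH μ c w`.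
[formal bookkeeping] -/
theorem semOKH_of_cutOK_colLeafE {μ μ₀ : ℤ} (hle : μ ≤ μ₀) (L : List (Bx × Bx)) (hL : ∀ b ∈ L, semOKH μ b.1 b.2 = true) :
    ∀ (t : CutTree ((Fin 3 × Fin 3) ⊕ Fin 3) (ℕ ⊕ (Unit ⊕ ExtLeafData))) (c w : Bx), cutOK (colLeafE L μ₀) t c w = true → semOKH μ c w = true :=
  semOKH_of_cutOK_leaves (colLeafE L μ₀) fun a c w h => by
    rcases a with i | u | e
    · exact coveredAt_sound (semOKH μ) (fun _ _ _ _ hc h => semOKH_anti_box hc h) L hL i c w h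
    · exact semOKH_of_entryLeafOKHC_level hle h
    · exact semOKH_of_exteriorOK h μ

/-- ★★ **THE hcp ROOT FACT FROM A MENU MANIFEST WITH EXTERIOR SLABS.** [formal bookkeeping] -/
theorem semOKH_root_of_colManifestE {μ μ₀ : ℤ} (hle : μ ≤ μ₀) (L : List (Bx × Bx)) (hL : ∀ b ∈ L, semOKH μ b.1 b.2 = true)
    (t : CutTree ((Fin 3 × Fin 3) ⊕ Fin 3) (ℕ ⊕ (Unit ⊕ ExtLeafData))) (h : cutOK (colLeafE L μ₀) t rootCH rootWH = true) :
    semOKH μ rootCH rootWH = true :=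
  semOKH_of_cutOK_colLeafE hle L hL t rootCH rootWH h

end Summit.AtomisticToContinuum.Crystallization.Theorems.FrustratedLawDichotomyStrainedPatchHomExteriorRay
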